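import Summits.QuantumFields.YangMills.Theorems.BalabanUVNodesN15KingModelSlicesOneCarrierHolder
import Summits.QuantumFields.YangMills.Theorems.BalabanUVNodesN15KingModelB9Thm31AllAtTrivialU
import HarnessLib

/-!
# BalabanUVNodes ∕ N15 — THE KING-MODEL RUNG, CURVED EDITION (PART Ρ-c): THE FINEST SLICE `G^η_{(0)} = C^{(0),η}` (THE ONE-STEP COVARIANCE OF THE FIRST
# RENORMALISATION STEP) ON THE SAME CARRIER — its (3.63) size and gradient clauses and its α-uniform Hölder clause (3.65)₁, ONE `(C, δ₀)` for all levels,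
# volumes and masses
# (Track A, DAG node N15 = NE2; FAN-OUT v1.1 §N15 s3 «KING-MODEL RUNG … + the one-line statement of what the curved case adds»)

HONEST FRAMING.  Count-neutral kernel bookkeeping (cell `pub-ymgap`, seat `pub-ymgap-dag-n15-e` g17; `--supports stmt-QuantumFields-27366 --as helper` =
K3⁸ `SpineGivenEndpointR13SepCoPHV`).  TEMPLATE LITERATURE, `A = 0`: C. King's scalar U(1)-Higgs MODEL on finite tori ([King1986] (2.16)–(2.17) p. 653, Prop.
3.7 (3.63)–(3.65) p. 663, p. 675 «When j = 0, we bound each term separately using Proposition 3.7»), NOT Bałaban's covariant objects; NE2⁺ is NOT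
PRINTED for those and not proved; NOT a node discharge; nothing continuum ∕ ℝ⁴ ∕ OS ∕ mass-gap ∕ Clay.  0 `sorry`, 0 `def`, standard axioms.

THE POINT.  In (2.17) `G^η_k = C^{(0),η} + Σ_{j ≥ 1} G^η_{(j)}` the `j = 0` slice is NOT a three-factor piece (`ℋ_0 = id`): it is the one-step covariance
`C^{(0),η} = (−Δ^η + m² + aL^{−2}Q_L^*Q_L)⁻¹` on the fine torus itself — in the tree's letters the `K = 1` edition of [Ba 4] (1.6): on `T_η ≅ Tor (fine L M′)`
(`M′_ν = 2L^{e_M + k − 1}`), `C^{(0),η} = L²·(fineOp L M′ (aK a L 1) L² (L²m_η²))⁻¹` (`aK a L 1 = a`; multiply the operator by `L²`).  Its decay is part Ψ-e's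
`fullPropOp_sup_decay` at `K = 1` (from O1 v1.2 `fineOp_inv_mulVec_decay_unif`, [Ba 4] (1.10)) against point sources; the block distance of the `L`-blocks is
the fine distance up to `∕L` and one unit (`tdistT_fine_le_blocks`); the identification with the level-`k` fine torus `Tor (fine (L^k) M)` is part Ρ-a's
`torCongr`.  The gradient clause at `j = 0` is the size clause twice (the slice length is ONE fine step), and the Hölder clause is part Ρ-b §1.
* §1 `fullProp_entry_eq_mulVec_single` (an entry of `A₀⁻¹` is `A₀⁻¹` on a point source), ★★ **`kingSliceZero_abs_le`** ((3.63)₁ at `j = 0`: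
  `|(fineOp L M′ a_1 L² m²)⁻¹(x, y)| ≤ C·e^{−δ₀|x − y|_{T_η}}`, ONE `(C, δ₀)` for all `k ≥ 1`, volumes, masses `0 < m² ≤ m₀²`), ★ `kingSliceZero_step_le`
  ((3.63)₂ at `j = 0`), ★★ **`kingSliceZero_holder_le`** ((3.65)₁ at `j = 0`, every `0 < α ≤ 1`, one constant).
WHAT THE CURVED CASE ADDS (one line): `C^{(0)}(Ω, A)` with a regular background and a sub-domain — [King1986] §4 ∕ [Ba 4]'s content.
HONEST SCOPE.  (i) `A = 0`, periodic b.c., odd `L ≥ 3`, `k ≥ 1`, `0 < m² ≤ m₀²` for the `K = 1` operator's mass parameter (King's `L²m²η²`); (ii) lattice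
units of `T_η` (King's `η^{2−D}` and the factor `L²` are the by-name file's); (iii) not Bałaban's `C^{(0)}(Ω, A)`; not a discharge.
Locators: [King1986] (2.16)–(2.17) p.653, Prop. 3.7 (3.63)–(3.65) p.663, (4.34) p.674, p.675; [Balaban1983RegularityDecay] (1.6) p.572, Theorem (1.10) p.573.
-/

noncomputable section

namespace Summit.QuantumFields.YangMills.BalabanUVNodes.N15KingModelRung.Curved

open Real Finset Matrix
open Literature.MathematicalPhysics.QuantumFieldTheory.Balaban1983to89.B5Prop11Plancherel (Tor fine unitVec)
open Literature.MathematicalPhysics.QuantumFieldTheory.King1986 (aK aK_pos aK_le)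
open Literature.MathematicalPhysics.QuantumFieldTheory.King1986.Torus (fineOp blockOf tdistT tdistT_nonneg tdistT_triangle tdistT_symm torCongr
  torCongr_add torCongr_unitVec tdistT_torCongr tdistT_add_unitVec_le)

variable {d : ℕ} (L : ℕ) [NeZero L]

/-! ## §1 The one-step covariance on the carrier: size, step, Hölder -/

omit [NeZero L] in
/-- An entry of a matrix is the matrix applied to a point source: `A(x, y) = (A·δ_y)(x)`. [folklore] -/
theorem entry_eq_mulVec_single {X : Type} [Fintype X] [DecidableEq X] (A : Matrix X X ℝ) (x y : X) : A x y = (A *ᵥ Pi.single y 1) x := by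
  rw [Matrix.mulVec_single_one]; rfl

/-- ★★ **(3.63)₁ AT `j = 0`**: there are `C, δ₀ > 0` such that for every `k ≥ 1`, cube exponent `e_M`, level-`k` volume `M` and unit volume `M′` with
`M′_ν = 2L^{e_M + k − 1}`, period identity `h0 : fine (L^k) M = fine (L^1) M′`, mass `0 < m² ≤ m₀²` and fine points `x, y ∈ T_η`:
`|(fineOp L^1 M′ (aK a L 1) (L^1)² m²)⁻¹(x, y)| ≤ C·e^{−δ₀|x − y|_{T_η}}` (part Ψ-e `fullPropOp_sup_decay` at `K = 1` on the point source `δ_y`, then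
`tdistT_fine_le_blocks`). [cite: King1986, Prop. 3.7 (3.63) p.663 (j = 0), (4.34) p.674; Balaban1983RegularityDecay, Theorem (1.10) p.573] -/
theorem kingSliceZero_abs_le (hLodd : Odd L) (hL : 2 ≤ L) {a : ℝ} (ha : 0 < a) {m0sq : ℝ} (hm0 : 0 ≤ m0sq) :
    ∃ C δ₀ : ℝ, 0 < C ∧ 0 < δ₀ ∧ ∀ (msq : ℝ), 0 < msq → msq ≤ m0sq →
      ∀ (k eM : ℕ) (M : Fin (d + 1) → ℕ) [∀ μ, NeZero (M μ)] (M' : Fin (d + 1) → ℕ) [∀ μ, NeZero (M' μ)], (∀ μ, M' μ = 2 * L ^ (eM + k - 1)) →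
      ∀ (h0 : ∀ μ, fine (L ^ k) M μ = fine (L ^ 1) M' μ) (x y : Tor (fine (L ^ k) M)),
        |(fineOp (L ^ 1) M' (aK a L 1) (((L ^ 1 : ℕ) : ℝ) ^ 2) msq)⁻¹ (torCongr h0 x) (torCongr h0 y)|
          ≤ C * Real.exp (-(δ₀ * tdistT (fine (L ^ k) M) x y)) := by
  classical
  obtain ⟨C, δ, hC, hδ, H⟩ := fullPropOp_sup_decay (d := d) L hLodd hL ha hm0
  have hL0 : (0 : ℝ) < L := by exact_mod_cast Nat.pos_of_ne_zero (NeZero.ne L)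
  have hL1r : (1 : ℝ) ≤ L := by exact_mod_cast Nat.one_le_iff_ne_zero.mpr (NeZero.ne L)
  refine ⟨C * Real.exp δ, δ / L, by positivity, div_pos hδ hL0, ?_⟩
  intro msq hmsq hcap k eM M _ M' _ hM' h0 x y
  set x' := torCongr h0 x with hx'
  set y' := torCongr h0 y with hy'
  set D : ℝ := tdistT M' (blockOf (L ^ 1) M' x') (blockOf (L ^ 1) M' y') with hD
  have h := H 1 le_rfl (L ^ 1) rfl (eM + k - 1) M' hM' msq hmsq hcap (Pi.single y' 1) 1 D
    (fun w => by by_cases hw : w = y' <;> simp [hw]) x' (fun w hw => by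
      have : w = y' := by by_contra hne; exact hw (by simp [hne])
      rw [this])
  rw [← entry_eq_mulVec_single] at h
  refine h.trans ?_
  rw [mul_one, mul_assoc]
  refine mul_le_mul_of_nonneg_left ?_ hC.le
  -- block distance of the `L`-blocks versus the fine distance
  have hfb := tdistT_fine_le_blocks (L ^ 1) M' x' y'
  rw [hx', hy', tdistT_torCongr h0] at hfb
  push_cast at hfb
  rw [pow_one] at hfb
  rw [← Real.exp_add]
  refine Real.exp_le_exp.mpr ?_
  have hDnn : 0 ≤ D := tdistT_nonneg M' _ _
  have h1 : δ / L * tdistT (fine (L ^ k) M) x y ≤ δ / L * (L * D + (L - 1)) := by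
    have := mul_le_mul_of_nonneg_left hfb (div_pos hδ hL0).le
    rw [hD]; exact this
  have h2 : δ / L * (L * D + (L - 1)) = δ * D + δ * ((L - 1) / L) := by field_simp
  have h3 : δ * (((L : ℝ) - 1) / L) ≤ δ := by
    have : ((L : ℝ) - 1) / L ≤ 1 := by rw [div_le_one hL0]; linarith
    nlinarith
  linarith

/-- ★ **(3.63)₂ AT `j = 0`** (the slice length is one fine step: the gradient clause is the size clause at two points): with the constants of
`kingSliceZero_abs_le`'s shape, `|C(x + e_μ, y) − C(x, y)| ≤ 2e^{δ₀}·C·e^{−δ₀|x − y|}`. [cite: King1986, Prop. 3.7 (3.63) p.663 (j = 0, second display)] -/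
theorem kingSliceZero_step_le {X : Fin (d + 1) → ℕ} [∀ μ, NeZero (X μ)] (F : Tor X → ℝ) (y : Tor X) {C δ₀ : ℝ} (hC : 0 ≤ C) (hδ : 0 ≤ δ₀)
    (hsize : ∀ w, |F w| ≤ C * Real.exp (-(δ₀ * tdistT X w y))) (x : Tor X) (μ : Fin (d + 1)) :
    |F (x + unitVec X μ) - F x| ≤ 2 * Real.exp δ₀ * C * Real.exp (-(δ₀ * tdistT X x y)) := by
  have h1 := hsize (x + unitVec X μ)
  have h2 := hsize x
  have hshift : Real.exp (-(δ₀ * tdistT X (x + unitVec X μ) y)) ≤ Real.exp δ₀ * Real.exp (-(δ₀ * tdistT X x y)) := by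
    rw [← Real.exp_add]
    refine Real.exp_le_exp.mpr ?_
    have ht : tdistT X x y ≤ tdistT X x (x + unitVec X μ) + tdistT X (x + unitVec X μ) y := tdistT_triangle X _ _ _
    have hu : tdistT X x (x + unitVec X μ) ≤ 1 := tdistT_add_unitVec_le X x μ
    nlinarith
  have hone : Real.exp (-(δ₀ * tdistT X x y)) ≤ Real.exp δ₀ * Real.exp (-(δ₀ * tdistT X x y)) :=
    le_mul_of_one_le_left (Real.exp_nonneg _) (Real.one_le_exp hδ)
  calc |F (x + unitVec X μ) - F x| ≤ |F (x + unitVec X μ)| + |F x| := abs_sub _ _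
    _ ≤ C * (Real.exp δ₀ * Real.exp (-(δ₀ * tdistT X x y))) + C * (Real.exp δ₀ * Real.exp (-(δ₀ * tdistT X x y))) :=
        add_le_add (h1.trans (mul_le_mul_of_nonneg_left hshift hC)) (h2.trans (mul_le_mul_of_nonneg_left hone hC))
    _ = 2 * Real.exp δ₀ * C * Real.exp (-(δ₀ * tdistT X x y)) := by ring

/-- ★★ **(3.65)₁ AT `j = 0`, EVERY `α ∈ (0, 1]`, ONE CONSTANT**: there are `C, δ₀ > 0` such that for every mass `0 < m² ≤ m₀²`, `k ≥ 1`, volumes as in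
`kingSliceZero_abs_le`, `0 < α ≤ 1` and fine points `x ≠ y`, `z`:
`|C^{(0)}(x, z) − C^{(0)}(y, z)| ≤ C·|x − y|_{T_η}^α·e^{−δ₀·min(|x−z|, |y−z|)}` (size + step ⇒ Hölder: part Ρ-b `holder_of_size_and_step` with `ℓ = 1`).
[cite: King1986, Prop. 3.7 (3.65) p.663 (j = 0), (3.62) p.663] -/
theorem kingSliceZero_holder_le (hLodd : Odd L) (hL : 2 ≤ L) {a : ℝ} (ha : 0 < a) {m0sq : ℝ} (hm0 : 0 ≤ m0sq) :
    ∃ C δ₀ : ℝ, 0 < C ∧ 0 < δ₀ ∧ ∀ (msq : ℝ), 0 < msq → msq ≤ m0sq →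
      ∀ (k eM : ℕ) (M : Fin (d + 1) → ℕ) [∀ μ, NeZero (M μ)] (M' : Fin (d + 1) → ℕ) [∀ μ, NeZero (M' μ)], (∀ μ, M' μ = 2 * L ^ (eM + k - 1)) →
      ∀ (h0 : ∀ μ, fine (L ^ k) M μ = fine (L ^ 1) M' μ) {α : ℝ}, 0 < α → α ≤ 1 →
      ∀ (x y z : Tor (fine (L ^ k) M)), 0 < tdistT (fine (L ^ k) M) x y →
        |(fineOp (L ^ 1) M' (aK a L 1) (((L ^ 1 : ℕ) : ℝ) ^ 2) msq)⁻¹ (torCongr h0 x) (torCongr h0 z)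
            - (fineOp (L ^ 1) M' (aK a L 1) (((L ^ 1 : ℕ) : ℝ) ^ 2) msq)⁻¹ (torCongr h0 y) (torCongr h0 z)|
          ≤ C * (tdistT (fine (L ^ k) M) x y) ^ α * Real.exp (-(δ₀ * min (tdistT (fine (L ^ k) M) x z) (tdistT (fine (L ^ k) M) y z))) := by
  obtain ⟨C₀, δ₀, hC₀, hδ₀, H₀⟩ := kingSliceZero_abs_le (d := d) L hLodd hL ha hm0
  set S : ℝ := 2 * Real.exp δ₀ * C₀ with hSdef
  have hS : 0 < S := by positivity
  refine ⟨((d : ℝ) + 3) * Real.exp δ₀ * S, δ₀, by positivity, hδ₀, ?_⟩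
  intro msq hmsq hcap k eM M _ M' _ hM' h0 α hα0 hα1 x y z hxy
  set A := (fineOp (L ^ 1) M' (aK a L 1) (((L ^ 1 : ℕ) : ℝ) ^ 2) msq)⁻¹ with hA
  set F : Tor (fine (L ^ k) M) → ℝ := fun w => A (torCongr h0 w) (torCongr h0 z) with hF
  have hsize0 : ∀ w, |F w| ≤ C₀ * Real.exp (-(δ₀ * tdistT (fine (L ^ k) M) w z)) := fun w => H₀ msq hmsq hcap k eM M M' hM' h0 w z
  have hC₀S : C₀ ≤ S := by
    rw [hSdef]
    have : 1 ≤ 2 * Real.exp δ₀ := by have := Real.one_le_exp hδ₀.le; linarith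
    nlinarith
  have hsize : ∀ w, |F w| ≤ S * Real.exp (-(δ₀ * (tdistT (fine (L ^ k) M) w z / 1))) := fun w => by
    rw [div_one]; exact (hsize0 w).trans (mul_le_mul_of_nonneg_right hC₀S (Real.exp_nonneg _))
  have hstep : ∀ w (μ : Fin (d + 1)), |F (w + unitVec (fine (L ^ k) M) μ) - F w| ≤ S / 1 * Real.exp (-(δ₀ * (tdistT (fine (L ^ k) M) w z / 1))) :=
    fun w μ => by
      rw [div_one, div_one]
      exact kingSliceZero_step_le F z hC₀.le hδ₀.le hsize0 w μ
  have h := holder_of_size_and_step (fine (L ^ k) M) F z hS.le one_pos hδ₀.le hsize hstep x y hxy hα0 hα1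
  simp only [div_one] at h
  simpa only [hF] using h

end Summit.QuantumFields.YangMills.BalabanUVNodes.N15KingModelRung.Curved

end
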